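import Literature.Computability.Cryptography.RegevReductionCVPqProgManuf
import Literature.Computability.Cryptography.RegevSamplerFormats
import Literature.Computability.Cryptography.RejectionSamplerArithFP
import HarnessLib

/-!
# Regev's CVP_q programs, IV: the post-processing program `post`

HONEST FRAMING. Part of a first formalisation of a KNOWN reduction (Regev 2009, worst-case
GapSVP/SIVP ≤ LWE, classical part). The value is a THEOREM about that reduction (plumbing: the
post-processing of Regev's `CVP_q` procedure — reading every block's coins and oracle answer off the
measured copies, re-deriving the block's fine samples, running the rational verification test of
Lemma 3.6 on the block's candidate, and writing the digit table of the first accepted candidate — is ONE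
polynomial-time string function, and on genuine inputs it returns exactly the tree's specification
`postOut`). It is NOT progress on any open problem and breaks nothing.

## What is proved

* exact rational mirrors `cosTurnQ`, `thresholdQ` of the tree's real-valued (but rational-operation)
  readout `cosTurn` and threshold `thresholdReadout` (`cast_cosTurnQ`, `cast_thresholdQ`), and their
  programs `codeFP_cosTurnQ`, `codeFP_thresholdQ`;
* `candL`, `accB` — a block's candidate (answer minus shift) and its acceptance bit, with the bridges
  `candL_ofFn`, `accB_eq` to the tree's `candidateK` / `accTest`;
* `firstCandL_eq` — the list search is the tree's `firstAcceptedK`;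
* `postL`, `codeFP_postL`, `postL_spec`, `exists_post` — the `post` / `post_mem_FP` / `post_spec`
  fields of `Regev2009.CVPqPrograms`.

## Sources

Regev 2009 (J. ACM 56(6):34; pages from arXiv:2401.03703): Lemma 3.6 p. 16 (the test
`z = (1/n)∑ cos(2π yᵢ)` against a threshold), Lemma 3.7 p. 16 (try the candidates, output an accepted
one), §3.2.1 "From samples to CVP" p. 15, Lemma 3.11 p. 18.
Bennett–Bernstein–Brassard–Vazirani 1997, Thm. 4.14 (layout of the copies). Arora–Barak 2009 §1.3.
-/

noncomputable section

namespace Literature.Computability.Cryptography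

namespace Regev2009

namespace CVPqProg

open _root_.Computability Literature.Computability.Complexity Literature.Computability.Complexity.CodeFP
  Literature.Computability.Complexity.Brick Literature.Algebra.EuclideanLattices Polynomial Finset
  Literature.LinearAlgebra.Matrix Literature.LinearAlgebra.Matrix.RowSelect Peikert2009 LWE DigitOracle
  SamplerFormats

variable {α β γ σ : Type} {eα : α → List Bool} {eβ : β → List Bool} {eσ : σ → List Bool}

/-! ### Exact rational mirrors of the verification arithmetic -/

/-- `π̃ = 3.1415925` as a rational. [folklore] -/
def piQQ : ℚ := 31415925 / 10000000

/-- `π̃` (rational) casts to `piQ`. [folklore] -/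
theorem cast_piQQ : ((piQQ : ℚ) : ℝ) = piQ := by rw [piQQ, piQ]; norm_num

/-- The doubling step on rationals. [folklore] -/
def dblQ (c : ℚ) : ℚ := 2 * c ^ 2 - 1

/-- [folklore] -/
theorem cast_dblQ (c : ℚ) : ((dblQ c : ℚ) : ℝ) = dbl c := by rw [dblQ, dbl]; push_cast; ring

/-- The small-angle cosine on rationals. [folklore] -/
def cosSmallQ (t : ℚ) : ℚ := 1 - (piQQ * t / 16) ^ 2 / 2

/-- [folklore] -/
theorem cast_cosSmallQ (t : ℚ) : ((cosSmallQ t : ℚ) : ℝ) = cosSmall t := by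
  rw [cosSmallQ, cosSmall, ← cast_piQQ]; push_cast; ring

/-- Five doublings on rationals. [folklore] -/
def cosQuarterQ (t : ℚ) : ℚ := dblQ (dblQ (dblQ (dblQ (dblQ (cosSmallQ t)))))

/-- [folklore] -/
theorem cast_cosQuarterQ (t : ℚ) : ((cosQuarterQ t : ℚ) : ℝ) = cosQuarter t := by
  rw [cosQuarterQ, cosQuarter, cast_dblQ, cast_dblQ, cast_dblQ, cast_dblQ, cast_dblQ, cast_cosSmallQ]

/-- The clamp on rationals. [folklore] -/
def clampQ (c : ℚ) : ℚ := max (-1) (min 1 c)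

/-- [folklore] -/
theorem cast_clampQ (c : ℚ) : ((clampQ c : ℚ) : ℝ) = clamp c := by rw [clampQ, clamp]; push_cast; rfl

/-- The fold onto `[0, ½]`. [folklore] -/
def foldQ (x : ℚ) : ℚ := if x ≤ 1 / 2 then x else 1 - x

/-- [folklore] -/
theorem cast_foldQ (x : ℚ) : ((foldQ x : ℚ) : ℝ) = if (x : ℝ) ≤ 1 / 2 then (x : ℝ) else 1 - x := by
  have h12 : (x : ℝ) ≤ 1 / 2 ↔ x ≤ 1 / 2 := by
    rw [show (1 / 2 : ℝ) = ((1 / 2 : ℚ) : ℝ) by norm_num, Rat.cast_le (K := ℝ)]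
  rw [foldQ]
  by_cases h : x ≤ 1 / 2
  · rw [if_pos h, if_pos (h12.2 h)]
  · rw [if_neg h, if_neg fun h' => h (h12.1 h')]; push_cast; ring

/-- **The turn-cosine on rationals** (exactly the tree's `cosTurn`, evaluated in `ℚ`).
[cite: RegevLWE2009, Lemma 3.6 (proof: the statistic `cos(2πy)`)] -/
def cosTurnQ (x : ℚ) : ℚ :=
  clampQ (if foldQ x ≤ 1 / 4 then cosQuarterQ (foldQ x) else -cosQuarterQ (1 / 2 - foldQ x))

/-- `cosTurnQ` casts to `cosTurn`. [folklore] -/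
theorem cast_cosTurnQ (x : ℚ) : ((cosTurnQ x : ℚ) : ℝ) = cosTurn x := by
  have h14 : ((foldQ x : ℚ) : ℝ) ≤ 1 / 4 ↔ foldQ x ≤ 1 / 4 := by
    rw [show (1 / 4 : ℝ) = ((1 / 4 : ℚ) : ℝ) by norm_num, Rat.cast_le (K := ℝ)]
  rw [cosTurnQ, cosTurn, ← cast_foldQ, cast_clampQ]
  refine congrArg clamp ?_
  by_cases h : foldQ x ≤ 1 / 4
  · rw [if_pos h, if_pos (h14.2 h), cast_cosQuarterQ]
  · rw [if_neg h, if_neg fun h' => h (h14.1 h'), Rat.cast_neg, cast_cosQuarterQ]; push_cast; ring_nf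

/-- Horner evaluation `c₀ + y(c₁ + y(…))`. [cite: KnuthTAOCP2, §4.6.4] -/
def horner (y : ℚ) (cs : List ℚ) : ℚ := cs.foldr (fun c acc => acc * y + c) 0

/-- Degree-9 Taylor value of `e^{-y}` on rationals. [folklore] -/
def expNegSmallQ (y : ℚ) : ℚ := ∑ m ∈ Finset.range 10, (-y) ^ m / (m.factorial : ℚ)

/-- [folklore] -/
theorem cast_expNegSmallQ (y : ℚ) : ((expNegSmallQ y : ℚ) : ℝ) = expNegSmall y := by
  rw [expNegSmallQ, expNegSmall]; push_cast; rfl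

/-- `expNegSmallQ` by Horner with the coefficients `(-1)^m/m!`. [folklore] -/
theorem expNegSmallQ_eq_horner (y : ℚ) :
    expNegSmallQ y = horner y [1, -1, 1 / 2, -1 / 6, 1 / 24, -1 / 120, 1 / 720, -1 / 5040, 1 / 40320, -1 / 362880] := by
  simp only [expNegSmallQ, horner, Finset.sum_range_succ, Finset.sum_range_zero, Nat.factorial, List.foldr]
  push_cast
  ring

/-- `e^{-x} ≈ expNegSmallQ(x/4)⁴` on rationals. [folklore] -/
def expNegApproxQ (x : ℚ) : ℚ := expNegSmallQ (x / 4) ^ 4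

/-- **The threshold on rationals** (exactly the tree's `thresholdReadout`, evaluated in `ℚ`).
[cite: RegevLWE2009, Lemma 3.6 (proof: threshold)] -/
def thresholdQ (a : ℚ) : ℚ := 15 / 32 * expNegApproxQ (piQQ * a ^ 2)

/-- `thresholdQ` casts to `thresholdReadout`. [folklore] -/
theorem cast_thresholdQ (a : ℚ) : ((thresholdQ a : ℚ) : ℝ) = thresholdReadout a := by
  rw [thresholdQ, thresholdReadout, expNegApproxQ, expNegApprox, ← cast_piQQ]
  push_cast
  rw [cast_expNegSmallQ]
  push_cast
  rfl

/-! ### Their programs -/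

/-- [cite: AroraBarak2009, §1.3] -/
theorem codeFP_dblQ : CodeFP encodeRat encodeRat dblQ :=
  (ratAdd.comp ((ratMul.comp ((const _ (2 : ℚ)).pair (ratMul.comp ((CodeFP.id _).pair (CodeFP.id _))))).pair
    (const _ (-1 : ℚ)))).congr fun c => by simp only [dblQ, id_eq]; ring

/-- [cite: AroraBarak2009, §1.3] -/
theorem codeFP_cosSmallQ : CodeFP encodeRat encodeRat cosSmallQ := by
  have hu : CodeFP encodeRat encodeRat (fun t => piQQ * t / 16) :=
    (ratDiv.comp ((ratMul.comp ((const _ piQQ).pair (CodeFP.id _))).pair (const _ (16 : ℚ))) :)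
  exact (ratAdd.comp ((const _ (1 : ℚ)).pair (ratMul.comp ((const _ (-1 / 2 : ℚ)).pair
    (ratMul.comp (hu.pair hu)))))).congr fun t => by rw [cosSmallQ]; ring

/-- [cite: AroraBarak2009, §1.3] -/
theorem codeFP_cosQuarterQ : CodeFP encodeRat encodeRat cosQuarterQ :=
  (codeFP_dblQ.comp (codeFP_dblQ.comp (codeFP_dblQ.comp (codeFP_dblQ.comp (codeFP_dblQ.comp codeFP_cosSmallQ))))).congr
    fun _ => rfl

/-- [cite: AroraBarak2009, §1.3] -/
theorem codeFP_clampQ : CodeFP encodeRat encodeRat clampQ :=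
  (ratMax.comp ((const _ (-1 : ℚ)).pair (ratMin.comp ((const _ (1 : ℚ)).pair (CodeFP.id _))))).congr fun _ => rfl

/-- [cite: AroraBarak2009, §1.3] -/
theorem codeFP_foldQ : CodeFP encodeRat encodeRat foldQ :=
  (ite (ratLe.comp ((CodeFP.id _).pair (const _ (1 / 2 : ℚ)))) (CodeFP.id _)
    (ratAdd.comp ((const _ (1 : ℚ)).pair (ratMul.comp ((const _ (-1 : ℚ)).pair (CodeFP.id _)))))).congr fun x => by
    simp only [foldQ, id, decide_eq_true_eq]
    split_ifs <;> ring

/-- **The turn-cosine is polynomial-time.** [cite: AroraBarak2009, §1.3] -/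
theorem codeFP_cosTurnQ : CodeFP encodeRat encodeRat cosTurnQ := by
  have hf := codeFP_foldQ
  have h1 : CodeFP encodeRat encodeRat (fun x => cosQuarterQ (foldQ x)) := (codeFP_cosQuarterQ.comp hf :)
  have h2 : CodeFP encodeRat encodeRat (fun x => -cosQuarterQ (1 / 2 - foldQ x)) :=
    (ratMul.comp ((const _ (-1 : ℚ)).pair (codeFP_cosQuarterQ.comp (ratAdd.comp ((const _ (1 / 2 : ℚ)).pair
      (ratMul.comp ((const _ (-1 : ℚ)).pair hf))))))).congr fun x => by ring_nf
  exact (codeFP_clampQ.comp (ite (ratLe.comp (hf.pair (const _ (1 / 4 : ℚ)))) h1 h2)).congr fun x => by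
    simp only [cosTurnQ, decide_eq_true_eq]

/-- Horner evaluation with fixed coefficients is polynomial-time. [cite: AroraBarak2009, §1.3] -/
theorem codeFP_horner : ∀ cs : List ℚ, CodeFP encodeRat encodeRat (fun y => horner y cs)
  | [] => (const _ (0 : ℚ)).congr fun _ => rfl
  | c :: cs => (ratAdd.comp ((ratMul.comp ((codeFP_horner cs).pair (CodeFP.id _))).pair (const _ c))).congr
      fun y => by rw [horner, horner, List.foldr_cons]; rfl

/-- **The threshold is polynomial-time.** [cite: AroraBarak2009, §1.3] -/
theorem codeFP_thresholdQ : CodeFP encodeRat encodeRat thresholdQ := by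
  have he : CodeFP encodeRat encodeRat expNegSmallQ :=
    (codeFP_horner _).congr fun y => (expNegSmallQ_eq_horner y).symm
  have hx : CodeFP encodeRat encodeRat (fun a => piQQ * a ^ 2 / 4) :=
    (ratDiv.comp ((ratMul.comp ((const _ piQQ).pair (ratMul.comp ((CodeFP.id _).pair (CodeFP.id _))))).pair
      (const _ (4 : ℚ)))).congr fun a => by rw [sq]; rfl
  have hp : CodeFP encodeRat encodeRat (fun a => expNegSmallQ (piQQ * a ^ 2 / 4)) := (he.comp hx :)
  have hp2 : CodeFP encodeRat encodeRat (fun a => expNegSmallQ (piQQ * a ^ 2 / 4) ^ 2) :=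
    (ratMul.comp (hp.pair hp)).congr fun a => by ring
  have hp4 : CodeFP encodeRat encodeRat (fun a => expNegSmallQ (piQQ * a ^ 2 / 4) ^ 4) :=
    (ratMul.comp (hp2.pair hp2)).congr fun a => by ring
  exact (ratMul.comp ((const _ (15 / 32 : ℚ)).pair hp4)).congr fun a => by rw [thresholdQ, expNegApproxQ]

/-! ### A block's candidate and its acceptance bit -/

/-- **The candidate of a block** (residues): answer minus shift, mod `q`.
[cite: RegevLWE2009, Lemma 4.1 (proof: "subtract the shift")] -/
def candL (p : ℕ) (u s : List ℕ) : List ℕ :=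
  cmodL p (List.zipWith (fun (ui si : ℕ) => ((si : ℤ) - (ui : ℤ))) u s)

/-- `candL` lists the residues of `s − u`. [folklore] -/
theorem candL_ofFn {n : ℕ} (p : ℕ) [NeZero p] (u s : Fin n → ZMod p) :
    candL p (List.ofFn fun i => (u i).val) (List.ofFn fun i => (s i).val) = List.ofFn fun i => ((s - u) i).val := by
  rw [candL, SamplerArithFP.zipWith_ofFn, cmodL, List.map_ofFn]
  congr 1; funext i
  simp only [Function.comp_apply, Pi.sub_apply]
  rw [← val_intCast_eq]
  congr 1
  push_cast
  rw [ZMod.natCast_zmod_val, ZMod.natCast_zmod_val]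

/-- `candL` on codes `(p, (u, s))`. [cite: AroraBarak2009, §1.3] -/
theorem codeFP_candL : CodeFP (pairE natE (pairE (rawE natE) (rawE natE))) (rawE natE) (fun x => candL x.1 x.2.1 x.2.2) := by
  have hg : CodeFP (pairE natE (pairE natE natE)) intE (fun t => ((t.2.2 : ℤ) - (t.2.1 : ℤ))) :=
    (intSub.comp ((intOfNat.comp (snd _ _).snd').pair (intOfNat.comp (snd _ _).fst')) :)
  have hz := zipWith (σ := ℕ) (eσ := natE) (eα := natE) (eβ := natE) (eγ := intE)
    (g := fun t => ((t.2.2 : ℤ) - (t.2.1 : ℤ))) hg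
  exact (codeFP_cmodL.comp ((fst _ _).pair hz)).congr fun _ => rfl

/-- **The residual of a fine sample against a candidate**, as the rational `val/(qK)` fed to the
turn-cosine: `val(b − K⟨a, c⟩ mod qK) / (qK)`. [cite: RegevLWE2009, Lemma 3.6 (proof)] -/
def resQ (p : ℕ) (c : List ℕ) (ab : List ℕ × ℕ) : ℚ :=
  (((((ab.2 : ℤ) - (schedK : ℕ) * ((dotN ab.1 c : ℕ) : ℤ)) % ((p * schedK : ℕ) : ℤ)).toNat : ℕ) : ℚ) /
    ((p * schedK : ℕ) : ℚ)

/-- The test statistic `∑ᵢ cosTurn(resᵢ)` of a fine batch. [cite: RegevLWE2009, Lemma 3.6 (proof)] -/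
def statQ (p : ℕ) (c : List ℕ) (fs : List (List ℕ × ℕ)) : ℚ := (fs.map fun ab => cosTurnQ (resQ p c ab)).sum

/-- **The acceptance bit**: `N_V · θ ≤ ∑ᵢ cosTurn(resᵢ)`. [cite: RegevLWE2009, Lemma 3.6 (proof)] -/
def accB (p NV : ℕ) (th : ℚ) (c : List ℕ) (fs : List (List ℕ × ℕ)) : Bool := decide ((NV : ℚ) * th ≤ statQ p c fs)

/-- The residual's value. [folklore] -/
theorem val_sub_kmul {n : ℕ} (p : ℕ) [NeZero p] (b : ZMod (p * schedK)) (aa c : Fin n → ZMod p) :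
    (b - kmul p schedK (aa ⬝ᵥ c)).val =
      (((b.val : ℤ) - (schedK : ℕ) * ((dotN (List.ofFn fun i => (aa i).val) (List.ofFn fun i => (c i).val) : ℕ) : ℤ)) %
        ((p * schedK : ℕ) : ℤ)).toNat := by
  rw [← val_intCast_eq, dotN_ofFn]
  congr 1
  have hdot : aa ⬝ᵥ c = (((∑ i, (aa i).val * (c i).val : ℕ) : ℤ) : ZMod p) := by
    push_cast
    simp [dotProduct]
  rw [hdot, kmul_intCast]
  have hb : b = (((b.val : ℕ) : ℤ) : ZMod (p * schedK)) := by
    rw [Int.cast_natCast, ZMod.natCast_zmod_val]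
  conv_lhs => rw [hb]
  push_cast
  ring

/-- **The acceptance bit is the tree's test** `accTest` (real threshold `θ̃_α`, `α = a` rational).
[cite: RegevLWE2009, Lemma 3.6 (proof)] -/
theorem accB_eq {n NV : ℕ} (p : ℕ) [NeZero p] (αr : ℝ) (a : ℚ) (hαa : αr = a) (c : Fin n → ZMod p)
    (F : Fin NV → (Fin n → ZMod p) × ZMod (p * schedK)) [Decidable (F ∈ accTest p NV αr c)] :
    accB p NV (thresholdQ a) (List.ofFn fun i => (c i).val)
        (List.ofFn fun i => (List.ofFn fun l => ((F i).1 l).val, (F i).2.val)) =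
      decide (F ∈ accTest p NV αr c) := by
  have hstat : statQ p (List.ofFn fun i => (c i).val) (List.ofFn fun i => (List.ofFn fun l => ((F i).1 l).val, (F i).2.val)) =
      ∑ i, cosTurnQ (resQ p (List.ofFn fun i => (c i).val) (List.ofFn fun l => ((F i).1 l).val, (F i).2.val)) := by
    rw [statQ, List.map_ofFn, List.sum_ofFn]; rfl
  have hset : F ∈ accTest p NV αr c ↔
      (NV : ℝ) * thresholdReadout αr ≤ ∑ i, cosTurn (((((F i).2 - kmul p schedK ((F i).1 ⬝ᵥ c)).val : ℕ) : ℝ) / ((p * schedK : ℕ) : ℝ)) := by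
    simp only [accTest, acceptSetStat, testStat, cosReadout, Set.mem_setOf_eq, Nat.cast_mul]
  rw [accB, hstat]
  refine Bool.decide_congr ?_
  rw [hset, hαa, ← cast_thresholdQ, ← Rat.cast_le (K := ℝ)]
  push_cast
  refine Iff.of_eq (congrArg _ (Finset.sum_congr rfl fun i _ => ?_))
  rw [cast_cosTurnQ, resQ, val_sub_kmul]
  push_cast
  rfl

/-- `resQ` on codes `((p, c), (a, b))`. [cite: AroraBarak2009, §1.3] -/
theorem codeFP_resQ : CodeFP (pairE (pairE natE (rawE natE)) (pairE (rawE natE) natE)) encodeRat (fun x => resQ x.1.1 x.1.2 x.2) := by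
  have hM : CodeFP (pairE (pairE natE (rawE natE)) (pairE (rawE natE) natE)) natE (fun x => x.1.1 * schedK) :=
    (natMul.comp ((fst _ _).fst'.pair (const _ schedK)) :)
  have hz : CodeFP (pairE (pairE natE (rawE natE)) (pairE (rawE natE) natE)) intE
      (fun x => ((x.2.2 : ℤ) - (schedK : ℕ) * ((dotN x.2.1 x.1.2 : ℕ) : ℤ)) % ((x.1.1 * schedK : ℕ) : ℤ)) :=
    intEModOf ((intSub.comp ((intOfNat.comp (snd _ _).snd').pair (intMul.comp ((const _ ((schedK : ℕ) : ℤ)).pair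
      (intOfNat.comp (codeFP_dotN.comp ((snd _ _).fst'.pair (fst _ _).snd'))))))) :) (intOfNat.comp hM)
  exact (ratOfIntNat.comp ((intOfNat.comp (intToNat.comp hz)).pair hM)).congr fun x => by
    simp only [resQ, Int.cast_natCast]

/-- `statQ` on codes `((p, c), fs)`. [cite: AroraBarak2009, §1.3] -/
theorem codeFP_statQ : CodeFP (pairE (pairE natE (rawE natE)) (rawE (pairE (rawE natE) natE))) encodeRat
    (fun x => statQ x.1.1 x.1.2 x.2) :=
  (ratSum.comp (map (σ := ℕ × List ℕ) (eσ := pairE natE (rawE natE)) (eα := pairE (rawE natE) natE) (eβ := encodeRat)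
    (g := fun t => cosTurnQ (resQ t.1.1 t.1.2 t.2))
    (codeFP_cosTurnQ.comp codeFP_resQ :))).congr fun _ => rfl

/-- `accB` on codes `((p, NV, θ), (c, fs))`. [cite: AroraBarak2009, §1.3] -/
theorem codeFP_accB : CodeFP (pairE (pairE natE (pairE natE encodeRat)) (pairE (rawE natE) (rawE (pairE (rawE natE) natE)))) bitE
    (fun x => accB x.1.1 x.1.2.1 x.1.2.2 x.2.1 x.2.2) := by
  have hNV : CodeFP (pairE (pairE natE (pairE natE encodeRat)) (pairE (rawE natE) (rawE (pairE (rawE natE) natE)))) encodeRat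
      (fun x => (x.1.2.1 : ℚ)) :=
    (ratOfIntNat.comp ((intOfNat.comp (fst _ _).snd'.fst').pair (const _ (1 : ℕ)))).congr fun x => by simp
  exact (ratLe.comp ((ratMul.comp (hNV.pair (fst _ _).snd'.snd')).pair (codeFP_statQ.comp (((fst _ _).fst'.pair
    (snd _ _).fst').pair (snd _ _).snd')))).congr fun _ => rfl

/-! ### The first accepted candidate -/

/-- **The candidate of the first accepting record**, else the default. [cite: RegevLWE2009, Lemma 3.7 (proof)] -/
def firstCandL (recs : List (Bool × List ℕ)) (dflt : List ℕ) : List ℕ :=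
  (recs.map Prod.snd).getD (recs.findIdx Prod.fst) dflt

/-- `firstCandL` on codes `(recs, dflt)`. [cite: AroraBarak2009, §1.3] -/
theorem codeFP_firstCandL : CodeFP (pairE (rawE (pairE bitE (rawE natE))) (rawE natE)) (rawE natE)
    (fun x => firstCandL x.1 x.2) := by
  have hidx : CodeFP (pairE (rawE (pairE bitE (rawE natE))) (rawE natE)) natE (fun x => x.1.findIdx Prod.fst) :=
    ((findIdxFP (σ := Unit) (eσ := unitE) (p := fun t : Unit × (Bool × List ℕ) => t.2.1) (snd _ _).fst').comp
      ((const _ ()).pair (fst _ _))).congr fun _ => rfl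
  have hc : CodeFP (pairE (rawE (pairE bitE (rawE natE))) (rawE natE)) (rawE (rawE natE)) (fun x => x.1.map Prod.snd) :=
    ((map₀ (snd _ _)).comp (fst _ _) :)
  exact ((rawGetOr (rawE natE)).comp (hc.pair (hidx.pair (snd _ _)))).congr fun _ => rfl

/-- **The list search is the tree's `firstAcceptedK`** (as the residue list of `getD 0`).
[cite: RegevLWE2009, Lemma 3.7 (proof)] -/
theorem firstCandL_eq {p K mm NV nB n : ℕ} [NeZero p] [NeZero K]
    (Acc : (Fin n → ZMod p) → Set (Fin NV → (Fin n → ZMod p) × ZMod (p * K)))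
    (D : Fin nB → (((Fin n → ZMod p) × (Fin mm → (Fin n → ZMod p) × ZMod p)) × (Fin n → ZMod p)) ×
      (Fin NV → (Fin n → ZMod p) × ZMod (p * K)))
    (rec : Fin nB → Bool × List ℕ) (hb : ∀ j, (rec j).1 = true ↔ AcceptsK p K mm NV Acc (D j))
    (hc : ∀ j, (rec j).2 = List.ofFn fun i => (candidateK p mm (D j).1 i).val) :
    firstCandL (List.ofFn rec) (List.replicate n 0) =
      List.ofFn fun i => (((firstAcceptedK p K mm NV Acc D).getD 0) i).val := by
  classical
  rw [firstAcceptedK]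
  have hlen : (List.ofFn rec).length = nB := List.length_ofFn
  by_cases h : ∃ j, AcceptsK p K mm NV Acc (D j)
  · rw [dif_pos h, Option.getD_some]
    obtain ⟨hi, hmin⟩ := (Fin.find_eq_iff h).1 rfl
    have hlt : ((Fin.find _ h : Fin nB) : ℕ) < (List.ofFn rec).length := by rw [hlen]; exact (Fin.find _ h).2
    have hidx : (List.ofFn rec).findIdx Prod.fst = ((Fin.find _ h : Fin nB) : ℕ) := by
      rw [List.findIdx_eq hlt]
      refine ⟨?_, fun j hj => ?_⟩
      · rw [List.getElem_ofFn]; exact (hb _).2 hi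
      · have hj' : j < nB := lt_trans hj (Fin.find _ h).2
        have hnot := hmin ⟨j, hj'⟩ (Fin.lt_def.2 hj)
        rw [← hb] at hnot
        rw [List.getElem_ofFn]
        simpa using hnot
    have hlt' : ((Fin.find _ h : Fin nB) : ℕ) < ((List.ofFn rec).map Prod.snd).length := by
      rw [List.length_map]; exact hlt
    rw [firstCandL, hidx, List.getD_eq_getElem?_getD, List.getElem?_eq_getElem hlt', Option.getD_some,
      List.getElem_map, List.getElem_ofFn]
    exact hc _
  · rw [dif_neg h, Option.getD_none]
    have hidx : (List.ofFn rec).findIdx Prod.fst = (List.ofFn rec).length := by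
      rw [List.findIdx_eq_length]
      intro x hx
      obtain ⟨j, rfl⟩ := List.mem_ofFn.1 hx
      have hnot : ¬ ((rec j).1 = true) := fun hj => h ⟨j, (hb j).1 hj⟩
      simpa using hnot
    have hge : ((List.ofFn rec).map Prod.snd).length ≤ (List.ofFn rec).length := by rw [List.length_map]
    rw [firstCandL, hidx, List.getD_eq_getElem?_getD, List.getElem?_eq_none hge, Option.getD_none]
    simp only [Pi.zero_apply, ZMod.val_zero]
    exact (List.ofFn_const n 0).symm

/-! ### The post-processing as a list program -/

/-- **The record of a block**: its acceptance bit and its candidate. [cite: RegevLWE2009, Lemma 3.7 (proof)] -/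
def recOf (p NV : ℕ) (th : ℚ) (B : (List ℕ × List (List ℕ × ℕ)) × List (List ℕ × ℕ)) (s : List ℕ) : Bool × List ℕ :=
  (accB p NV th (candL p B.1.1 s) B.2, candL p B.1.1 s)

/-- `recOf` on codes `((p, NV, θ), (B, s))`. [cite: AroraBarak2009, §1.3] -/
theorem codeFP_recOf : CodeFP (pairE (pairE natE (pairE natE encodeRat)) (pairE boutE (rawE natE))) (pairE bitE (rawE natE))
    (fun x => recOf x.1.1 x.1.2.1 x.1.2.2 x.2.1 x.2.2) := by
  have hc : CodeFP (pairE (pairE natE (pairE natE encodeRat)) (pairE boutE (rawE natE))) (rawE natE)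
      (fun x => candL x.1.1 x.2.1.1.1 x.2.2) :=
    (codeFP_candL.comp ((fst _ _).fst'.pair ((snd _ _).fst'.fst'.fst'.pair (snd _ _).snd')) :)
  exact ((codeFP_accB.comp ((fst _ _).pair (hc.pair (snd _ _).fst'.snd'))).pair hc).congr fun _ => rfl

/-- **The record of block `j` read off its segment `σ`**: coins `(fstF (fstF σ)).drop XK`, answer
`sndF (fstF σ)`. [cite: RegevLWE2009, Lemma 3.7 (proof)] -/
def postRec (q m : ℕ → ℕ) (a : ℕ → ℚ) (samp : List Bool → List Bool) (pc : Polynomial ℕ) (n : ℕ)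
    (rows : List (List ℤ)) (batch : List (ℕ × List ℤ)) (ts : List ℚ) (XK j : ℕ) (sg : List Bool) : Bool × List ℕ :=
  recOf (q n) (nVerify n) (thresholdQ (a n)) (blockVals q m a samp pc n rows batch ts j ((fstF (fstF sg)).drop XK))
    (secretL n (q n) (sndF (fstF sg)))

/-- `|x| + K` of the data. [folklore] -/
def XKOf (pK : Polynomial ℕ) (d : QData) : ℕ := (qE d).length + (pK.eval (qE d).length + 1)

/-- The block width `b = (|x| + K) + p_F(|x| + K) + 2`. [cite: BennettBernsteinBrassardVazirani1997, Thm. 4.14 (proof: layout)] -/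
def bOf (pK pF : Polynomial ℕ) (d : QData) : ℕ := XKOf pK d + pF.eval (XKOf pK d) + 2

/-- The number of blocks `(24 m + 2)(n + 1)`. [cite: RegevLWE2009, Lemma 3.7 (proof)] -/
def nBlkN (m : ℕ → ℕ) (n : ℕ) : ℕ := (24 * m n + 2) * (n + 1)

/-- `nBlkN = nBlk`. [folklore] -/
theorem nBlkN_eq (m : ℕ → ℕ) (n : ℕ) : nBlkN m n = nBlk m n := rfl

/-- The records of all blocks. [cite: RegevLWE2009, Lemma 3.7 (proof)] -/
def recsL (q m : ℕ → ℕ) (a : ℕ → ℚ) (samp : List Bool → List Bool) (pc pK pF : Polynomial ℕ) (d : QData)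
    (y : List Bool) : List (Bool × List ℕ) :=
  (wordsL (bOf pK pF d) (nBlkN m d.1.1.1.n) (y.drop (bOf pK pF d + 1))).mapIdx fun j sg =>
    postRec q m a samp pc d.1.1.1.n (GapCodes.matRows d.1.1.1.basis) d.1.2.2 d.2 (XKOf pK d) j sg

/-- **The post-processing** on the typed view `(d, y)` of `⟨x, y⟩`: the digit table of the first
accepted candidate (or of `0`). [cite: RegevLWE2009, Lemma 3.7 (proof); Regev2009, §3.2.1] -/
def postL (q m : ℕ → ℕ) (a : ℕ → ℚ) (samp : List Bool → List Bool) (pc pK pF : Polynomial ℕ) (d : QData)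
    (y : List Bool) : List Bool :=
  tableL (Nat.size (q d.1.1.1.n)) (firstCandL (recsL q m a samp pc pK pF d y) (List.replicate d.1.1.1.n 0))

/-! ### Correctness on genuine inputs -/

/-- `mapIdx` over `ofFn`. [folklore] -/
theorem mapIdx_ofFn {δ ε : Type} {k : ℕ} (g : Fin k → δ) (h : ℕ → δ → ε) :
    (List.ofFn g).mapIdx h = List.ofFn fun j => h j (g j) := by
  apply List.ext_getElem (by simp)
  intro i h₁ h₂
  simp

/-- A width-`b` chunk of `y` after the front window is the block string of the layout. [folklore] -/
theorem chunk_eq_blockStr (pK : Polynomial ℕ) (Pc : QuantumComplexity.PolyCopies.Params) (hPc : Pc.pK = pK) (d : QData)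
    (y : List Bool) (j : ℕ) :
    chunk (bOf pK Pc.pF d) (y.drop (bOf pK Pc.pF d + 1)) j = blockStr Pc (qE d).length y j := by
  have hb : bOf pK Pc.pF d = QuantumComplexity.PolyCopiesIdx.b Pc (qE d).length := by
    rw [bOf, XKOf, QuantumComplexity.PolyCopiesIdx.b, QuantumComplexity.PolyCopiesIdx.nIn, QuantumComplexity.PolyCopiesIdx.K,
      hPc]
  rw [chunk, blockStr, QuantumComplexity.PolyCopiesIdx.blk, QuantumComplexity.PolyCopiesIdx.base, hb, List.drop_drop]
  refine congrArg (List.take _) (congrArg (fun s => List.drop s y) ?_)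
  ring

/-- **The post-processing is correct.** [cite: RegevLWE2009, Lemma 3.7 (proof); Regev2009, §3.2.1] -/
theorem postL_spec (q : ℕ → ℕ) [∀ n, NeZero (q n)] (α : ℕ → ℝ) (m : ℕ → ℕ) (a : ℕ → ℚ) (hαa : ∀ n, α n = a n)
    (samp : List Bool → List Bool) (pc pK : Polynomial ℕ) (Pc : QuantumComplexity.PolyCopies.Params) (hPc : Pc.pK = pK)
    (I : LatticeInstance) (hI : I.IsNonsingular) (ρ : ℚ) (k : ℕ) (t : Fin I.n → ℚ) {P : ℕ} (w : Fin P → I.lattice)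
    (hP : nVectors (m I.n) I.n ≤ P) (y : List Bool) :
    postL q m a samp pc pK Pc.pF (qOf I ρ k t w) y =
      postOut q α m I.n fun j => readSeg q m a samp pc I hI t w hP (queryOf I ρ k t w).length
        (pK.eval (queryOf I ρ k t w).length + 1) j (blockStr Pc (queryOf I ρ k t w).length y j) := by
  classical
  have hX : (qE (qOf I ρ k t w)).length = (queryOf I ρ k t w).length := by rw [qE_qOf]
  rw [postL, postOut, optTable, ← tableL_ofFn, show (qOf I ρ k t w).1.1.1 = I from rfl, recsL, wordsL, mapIdx_ofFn]
  refine congrArg (tableL (Nat.size (q I.n))) ?_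
  refine firstCandL_eq (nB := nBlk m I.n) _ _ (fun j : Fin (nBlk m I.n) => postRec q m a samp pc I.n
    (GapCodes.matRows I.basis) (qOf I ρ k t w).1.2.2 (qOf I ρ k t w).2 (XKOf pK (qOf I ρ k t w)) j
    (chunk (bOf pK Pc.pF (qOf I ρ k t w)) (y.drop (bOf pK Pc.pF (qOf I ρ k t w) + 1)) j)) (fun j => ?_) (fun j => ?_)
  all_goals
    rw [chunk_eq_blockStr pK Pc hPc, hX, postRec, show (qOf I ρ k t w).2 = List.ofFn t from rfl,
      show (qOf I ρ k t w).1.2.2 = List.ofFn (fun i => (I.n, List.ofFn (I.intCoords (w i)))) from rfl,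
      blockVals_eq q m a samp pc I hI t w hP j, secretL_eq_ofFn, XKOf, hX, readSeg, blockResult]
    simp only [recOf, valsOf]
    rw [candL_ofFn]
  · rw [AcceptsK, candidateK, accB_eq (q I.n) (α I.n) (a I.n) (hαa I.n), decide_eq_true_iff]
  · rfl

/-! ### The programs are polynomial-time -/

/-- Code of the post-processing context `(n, rows, batch, ts, |x| + K)` (`n`, `|x| + K` unary). [folklore] -/
abbrev ctxE : (ℕ × List (List ℤ) × List (ℕ × List ℤ) × List ℚ × ℕ) → List Bool :=
  pairE unE (pairE (rawE (rawE intE)) (pairE (rawE (pairE natE (listE smE))) (pairE (rawE encodeRat) unE)))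

/-- **A block's record is polynomial-time** in `(context, (j, segment))`. [cite: AroraBarak2009, §1.3] -/
theorem codeFP_postRec {q m : ℕ → ℕ} {a : ℕ → ℚ} {samp : List Bool → List Bool} (pc : Polynomial ℕ)
    (hq : PolyTimeComputable unaryEncodeNat encodeNat q) (hm : PolyTimeComputable unaryEncodeNat encodeNat m)
    (hpm : IsPolyBounded m) (ha : PolyTimeComputable unaryEncodeNat encodeRat a) (hsamp : samp ∈ FP) :
    CodeFP (pairE ctxE (pairE natE strE)) (pairE bitE (rawE natE))
      (fun x => postRec q m a samp pc x.1.1 x.1.2.1 x.1.2.2.1 x.1.2.2.2.1 x.1.2.2.2.2 x.2.1 x.2.2) := by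
  have cn : CodeFP (pairE ctxE (pairE natE strE)) unE (fun x => x.1.1) := (fst _ _).fst'
  have crows : CodeFP (pairE ctxE (pairE natE strE)) (rawE (rawE intE)) (fun x => x.1.2.1) := (fst _ _).snd'.fst'
  have cbatch : CodeFP (pairE ctxE (pairE natE strE)) (rawE (pairE natE (listE smE))) (fun x => x.1.2.2.1) :=
    (fst _ _).snd'.snd'.fst'
  have cts : CodeFP (pairE ctxE (pairE natE strE)) (rawE encodeRat) (fun x => x.1.2.2.2.1) := (fst _ _).snd'.snd'.snd'.fst'
  have cXK : CodeFP (pairE ctxE (pairE natE strE)) unE (fun x => x.1.2.2.2.2) := (fst _ _).snd'.snd'.snd'.snd'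
  have cj : CodeFP (pairE ctxE (pairE natE strE)) natE (fun x => x.2.1) := (snd _ _).fst'
  have csg : CodeFP (pairE ctxE (pairE natE strE)) strE (fun x => x.2.2) := (snd _ _).snd'
  have hfst : CodeFP strE strE fstF := of_fn fstF fstF_mem_FP fun _ => rfl
  have hsnd : CodeFP strE strE sndF := of_fn sndF sndF_mem_FP fun _ => rfl
  have cr : CodeFP (pairE ctxE (pairE natE strE)) strE (fun x => (fstF (fstF x.2.2)).drop x.1.2.2.2.2) :=
    (strDrop.comp (cXK.pair (hfst.comp (hfst.comp csg))) :)
  have cans : CodeFP (pairE ctxE (pairE natE strE)) strE (fun x => sndF (fstF x.2.2)) := (hsnd.comp (hfst.comp csg) :)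
  have cB := ((codeFP_blockVals pc hq hm hpm ha hsamp).comp (cn.pair (crows.pair (cbatch.pair (cts.pair (cj.pair cr))))) :)
  have cq : CodeFP (pairE ctxE (pairE natE strE)) natE (fun x => q x.1.1) := ((codeFP_natParam hq).comp cn :)
  have cs : CodeFP (pairE ctxE (pairE natE strE)) (rawE natE) (fun x => secretL x.1.1 (q x.1.1) (sndF (fstF x.2.2))) :=
    (codeFP_secretL.comp (cn.pair (cq.pair cans)) :)
  have cNV : CodeFP (pairE ctxE (pairE natE strE)) natE (fun x => nVerify x.1.1) :=
    (natOfUn.comp ((unMulConst 2).comp ((unMulConst 800000).comp (unSucc.comp cn)))).congr fun x => by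
      simp only [nVerify_eq, id_eq]
  have cth : CodeFP (pairE ctxE (pairE natE strE)) encodeRat (fun x => thresholdQ (a x.1.1)) :=
    (codeFP_thresholdQ.comp ((ofPolyTimeComputable_unE ha).comp cn) :)
  exact (codeFP_recOf.comp ((cq.pair (cNV.pair cth)).pair (cB.pair cs))).congr fun _ => rfl

/-- **The post-processing is polynomial-time.** [cite: AroraBarak2009, §1.3] -/
theorem codeFP_postL {q m : ℕ → ℕ} {a : ℕ → ℚ} {samp : List Bool → List Bool} (pc pK pF : Polynomial ℕ)
    (hq : PolyTimeComputable unaryEncodeNat encodeNat q) (hm : PolyTimeComputable unaryEncodeNat encodeNat m)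
    (hpm : IsPolyBounded m) (ha : PolyTimeComputable unaryEncodeNat encodeRat a) (hsamp : samp ∈ FP) :
    CodeFP mE strE (fun p => postL q m a samp pc pK pF p.1 p.2) := by
  obtain ⟨pm, hpm'⟩ := id hpm
  have hinst : CodeFP mE GapSVPInstance.encode (fun p => p.1.1.1) := (fst _ _).fst'.fst'
  have hn : CodeFP mE unE (fun p => p.1.1.1.1.n) := (GapCodes.svpNUn_codeFP.comp hinst :)
  have hrows : CodeFP mE (rawE (rawE intE)) (fun p => GapCodes.matRows p.1.1.1.1.basis) := (codeFP_matRows.comp hinst :)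
  have hbatch : CodeFP mE (rawE (pairE natE (listE smE))) (fun p => p.1.1.2.2) := (fst _ _).fst'.snd'.snd'
  have hts : CodeFP mE (rawE encodeRat) (fun p => p.1.2) := ((rawOfList encodeRat).comp (fst _ _).snd' :)
  have hy : CodeFP mE strE (fun p => p.2) := snd _ _
  have hX : CodeFP mE unE (fun p => (qE p.1).length) := ((codeLenU qE).comp (fst _ _) :)
  have hK : CodeFP mE unE (fun p => pK.eval (qE p.1).length + 1) :=
    ((codePolyLenU qE (pK + 1)).comp (fst _ _)).congr fun p => by simp
  have hXK : CodeFP mE unE (fun p => XKOf pK p.1) := (unAdd.comp (hX.pair hK)).congr fun p => by simp only [XKOf]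
  have hb : CodeFP mE unE (fun p => bOf pK pF p.1) :=
    (unAdd.comp ((unAdd.comp (hXK.pair ((codePolyLenU unE pF).comp hXK))).pair (const _ (2 : ℕ)))).congr fun p => by
      simp [bOf]
  have hmU : CodeFP mE unE (fun p => m p.1.1.1.1.n) :=
    (unOfNatMin.comp (((codePolyLenU unE pm).comp hn).pair ((codeFP_natParam hm).comp hn))).congr fun p => by
      simpa using (min_eq_left (hpm' p.1.1.1.1.n)).symm
  have hnB : CodeFP mE unE (fun p => nBlkN m p.1.1.1.1.n) :=
    ((_root_.Literature.Computability.QuantumComplexity.unMul_codeFP).comp ((unAdd.comp (((unMulConst 24).comp hmU).pair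
      (const _ (2 : ℕ)))).pair (unSucc.comp hn))).congr fun _ => by simp only [nBlkN]
  have hblocks : CodeFP mE (rawE strE) (fun p => wordsL (bOf pK pF p.1) (nBlkN m p.1.1.1.1.n) (p.2.drop (bOf pK pF p.1 + 1))) :=
    (codeFP_wordsL.comp (hb.pair (hnB.pair (strDrop.comp ((unSucc.comp hb).pair hy)))) :)
  have hctx : CodeFP mE ctxE (fun p => (p.1.1.1.1.n, GapCodes.matRows p.1.1.1.1.basis, p.1.1.2.2, p.1.2, XKOf pK p.1)) :=
    hn.pair (hrows.pair (hbatch.pair (hts.pair hXK)))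
  have hrecs : CodeFP mE (rawE (pairE bitE (rawE natE))) (fun p => recsL q m a samp pc pK pF p.1 p.2) :=
    ((mapIdx (σ := ℕ × List (List ℤ) × List (ℕ × List ℤ) × List ℚ × ℕ) (eσ := ctxE) (eα := strE) (eβ := pairE bitE (rawE natE))
      (g := fun x => postRec q m a samp pc x.1.1 x.1.2.1 x.1.2.2.1 x.1.2.2.2.1 x.1.2.2.2.2 x.2.1 x.2.2)
      (codeFP_postRec pc hq hm hpm ha hsamp)).comp (hctx.pair hblocks)).congr fun _ => rfl
  have hdflt : CodeFP mE (rawE natE) (fun p => List.replicate p.1.1.1.1.n 0) :=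
    ((replicateOf natE).comp ((const _ (0 : ℕ)).pair hn) :)
  have hcand : CodeFP mE (rawE natE) (fun p => firstCandL (recsL q m a samp pc pK pF p.1 p.2) (List.replicate p.1.1.1.1.n 0)) :=
    (codeFP_firstCandL.comp (hrecs.pair hdflt) :)
  have hsz : CodeFP mE unE (fun p => Nat.size (q p.1.1.1.1.n)) :=
    ((codeLenU natE).comp ((codeFP_natParam hq).comp hn)).congr fun p => by simp [TM2Pass.length_encodeNat_eq_size]
  exact (codeFP_tableL.comp (hsz.pair hcand)).congr fun _ => rfl

/-! ### The `post` field of `CVPqPrograms` -/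

/-- **The post-processing as ONE string function in `FP` per layout**, with the specification of
`Regev2009.CVPqPrograms.post_spec`. [cite: RegevLWE2009, Lemma 3.7 (proof), §3.2.1]; [cite: AroraBarak2009, §1.3] -/
theorem exists_post (q : ℕ → ℕ) [∀ n, NeZero (q n)] (α : ℕ → ℝ) (m : ℕ → ℕ) (a : ℕ → ℚ) (hαa : ∀ n, α n = a n)
    (samp : List Bool → List Bool) (pc pK : Polynomial ℕ) (hq : PolyTimeComputable unaryEncodeNat encodeNat q)
    (hm : PolyTimeComputable unaryEncodeNat encodeNat m) (hpm : IsPolyBounded m)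
    (ha : PolyTimeComputable unaryEncodeNat encodeRat a) (hsamp : samp ∈ FP) :
    ∃ post : QuantumComplexity.PolyCopies.Params → List Bool → List Bool, (∀ Pc, post Pc ∈ FP) ∧
      ∀ Pc : QuantumComplexity.PolyCopies.Params, Pc.pK = pK →
        ∀ (I : LatticeInstance) (hI : I.IsNonsingular) (ρ : ℚ) (k : ℕ) (t : Fin I.n → ℚ) (P : ℕ) (w : Fin P → I.lattice)
          (hP : nVectors (m I.n) I.n ≤ P) (y : List Bool),
          post Pc (boolPair (queryOf I ρ k t w) y) =
            postOut q α m I.n fun j => readSeg q m a samp pc I hI t w hP (queryOf I ρ k t w).length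
              (pK.eval (queryOf I ρ k t w).length + 1) j (blockStr Pc (queryOf I ρ k t w).length y j) := by
  have h := fun Pc : QuantumComplexity.PolyCopies.Params => codeFP_postL (q := q) (m := m) (a := a) pc pK Pc.pF hq hm hpm ha hsamp
  choose post hpost hspec using h
  refine ⟨post, hpost, fun Pc hPc I hI ρ k t P w hP y => ?_⟩
  have h1 := hspec Pc (qOf I ρ k t w, y)
  rw [show mE (qOf I ρ k t w, y) = boolPair (queryOf I ρ k t w) y by rw [← qE_qOf]; rfl] at h1
  rw [h1]
  exact postL_spec q α m a hαa samp pc pK Pc hPc I hI ρ k t w hP y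

end CVPqProg

end Regev2009

end Literature.Computability.Cryptography
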